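import Summits.BirchSwinnertonDyer.BirchSwinnertonDyer.Theorems.GenusKolyvaginAtTwoShaCorestrictionLocalTransport
import Literature.NumberTheory.EllipticCurves.PeriodIndexCorestrictionLocal
import Summits.BirchSwinnertonDyer.Rank1Residual.Additive.EmbeddingPlaceFactorisation
import Summits.BirchSwinnertonDyer.Rank1Residual.Additive.InfiniteCompletionGaloisConj
import HarnessLib

/-!
# Route `GenusKolyvaginAtTwo` — CORESTRICTION MAPS `Ш(E_K/K)` INTO `Ш(E/ℚ)` (the double-coset / local-triviality
# argument on the tree's `Ш`), for `K/ℚ` finite Galois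

Seat `bsd-line-gk2-p4` g28 (cell `bsd-f1-sign2`), WIDTH-5 attach on route `GenusKolyvaginAtTwo` rev 57; helper of the
K₄/K₄⁺ consistency law (one-bit law) of gk2-p4 g27 — `…ShaCardDvdPowAtTwoPosTDefectOneBitLaw{,Exact,Kernel}` carry the
DISPLAYED binders `hcorE : ∀ c ∈ Ш(E_K/K), corBaseChange … c ∈ Ш(E/ℚ)` / `hcorT` («the local double-coset
compatibility of corestriction — PRINT»), and `Literature/…/ShaCorestrictionIndexTwo.lean` flags «NOT HERE (by design):
cor maps Ш(E_K/K) into Ш(E/ℚ) for a GENERAL E».  THIS FILE PROVES IT for the general corestriction `coresH1` of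
`PeriodIndexCorestriction.lean` along `galRange K ≤ Γ_ℚ` composed with the model map `galH1Model` (any finite Galois
`K/ℚ`): **`coresH1_galH1Model_mem_sha`**.  (The identification with the index-`2` `corBaseChange` of a quadratic `K` is
`corH1_eq_coresH1`, file `Literature/…/H1CorestrictionIndexTwoEqCores.lean`; the by-name discharge of `hcorE`/`hcorT`
is the sequel.)  THEOREMS ONLY (no definition, no named fact, no `sorry`).  BSD is NOT proved by this file; nothing is
closed by it.

## The argument (Milne ADT I Rem. 6.10 / Fisher 2003 proof of Prop. 2.16 / NSW I.§5)

For `x ∈ Ш(E_K/K)` and a place `v` of `ℚ` with completion `E = ℚ_v`, decomposition map `φ = resGal E : Γ_E → Γ_ℚ`,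
`N = galRange K`: Clark–Sharif's local triviality of corestriction (`resH1Hom_coresH1_eq_zero`, the Mackey formula
`res_v ∘ cores = Σ_{w ∣ v} cores_w ∘ res_w`) reduces `res_v (cores θ) = 0` (`θ = galH1Model x ∈ H¹(N, E(ℚ̄))`) to the
vanishing of `res_{(φ|_{φ⁻¹N}, E(ℚ̄) → E(Ē))} (g_* θ)` for every `g ∈ Γ_ℚ` (§5).  Changing the embedding `ℚ̄ → Ē` by `g`
conjugates the class (§1, `resH1Hom_resGalSubgroupOfEmb_comp`), so it suffices to treat EVERY `ℚ`-embedding `ι : ℚ̄ → Ē`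
(§4): `ι|_K` factors through a completion `K_w`, `w ∣ v` (`exists_place_factorisation` /
`exists_infinitePlace_factorisation`, cell `b2b`/`t42`), and on `φ⁻¹N = Gal(Ē/E·ι(K))` the restriction of `θ` is the
transport of the `K_w`-local restriction of `x` along `Ē ≃ (K_w)‾` (§2–§3, the `E(K̄)`-coefficient port of t42's
`localResOverOfEmb_resH1Hom_eq_zero`), which vanishes because `x ∈ Ш(E_K/K)`.

* §1–§3 (prequel `…ShaCorestrictionLocalTransport`): change of embedding = conjugation; the coefficient identity; the
  transfer of a local vanishing along `(ι, ι₂, ι')` for the model pair `(rangeToResGal, ψ)`, `ψ ∘ θ = id`.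
* §4 `resH1Hom_model_eq_zero_of_factorisation`, `…_adicCompletion`, `…_infinitePlace` — every embedding (finite Galois
  `L/F` of number fields).
* §5 `resH1Hom_conjH1_galH1Model_eq_zero_adicCompletion` / `_infinitePlace` — the `g_*` form at the chosen embedding.
* §6 ★ `coresH1_galH1Model_mem_localRestrictionKer_adicCompletion` / `_infinitePlace`, ★ `coresH1_galH1Model_mem_sha`.

References: [MilneADT2006] I.§6 Rem. 6.10; [Fisher2003] Prop. 2.16 (proof); [NeukirchSchmidtWingberg2008] I.§5;
[ClarkSharif2010] §3.6; [SerreGaloisCohomology1997] I.§2.4, II.§1.1.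
-/

set_option autoImplicit false
set_option linter.dupNamespace false -- `Summit.<P>.<Sub>` repeats `BirchSwinnertonDyer` (D-0017)

noncomputable section

open scoped Classical NumberField.LiesOver

universe u

namespace Summit.BirchSwinnertonDyer.BirchSwinnertonDyer.Theorems.GenusExact.ShaCores

open WeierstrassCurve NumberField IsDedekindDomain Literature.NumberTheory.EllipticCurves
  Literature.NumberTheory.GaloisRepresentations
  Summit.BirchSwinnertonDyer.Rank1Residual.Additive.LocalTransport

/-! ## §4 The local step at a factorisation; every embedding -/

section Factorisation

variable {F : Type u} [Field F] (L : Type u) [Field L] [Algebra F L] [Algebra.IsAlgebraic F L] [PerfectField L]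
  (W : WeierstrassCurve F)
variable {E : Type u} [Field E] [Algebra F E] {E' : Type u} [Field E'] [Algebra L E'] [Algebra F E'] [IsScalarTower F L E']
variable (ψ : geomPoints (W.baseChange L) →+ geomPoints W)

/-- **Generic local step** (`E(K̄)`-coefficient / model-map twin of t42's
`subgroupModelIso_mem_localKerOverOfEmb_of_factorisation`).  For an `F`-field `E`, an `L`-field `E'`, `f : E → E'`, an
`F`-embedding `ι : F̄ → Ē` and `ε : E' → Ē` with `ε ∘ f = (E → Ē)`, `ε|_L = ι ∘ j_L` and `E' = ⟨f(E), L⟩`: if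
`x ∈ H¹(L, E_L)` dies at the `L`-field `E'`, then its model class `res_{(rangeToResGal, θ⁻¹)} x ∈ H¹(galRange L, E(F̄))`
dies under the local restriction attached to `ι` on `H_ι = Gal(Ē/E·ι(L))`.  The elements of `Γ_E` restricting into
`galRange L` fix `ε(E′)`; `Ē ≃ Ē'` over `E'` (both algebraic closures); the local kernel at `E'` does not depend on the
`L`-embedding (`localRestrictionKerOfEmb_eq_holds`). [cite: SerreGaloisCohomology1997, II.§1.1] [cite: MilneADT2006, I.§6 Rem. 6.10] -/
theorem resH1Hom_model_eq_zero_of_factorisation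
    (hψ : ∀ (n : galRange (K := F) L) (Q : geomPoints (W.baseChange L)), ψ (rangeToResGal (K := F) L n • Q) = n • ψ Q)
    (hψspec : ∀ P : geomPoints W, ψ (localPointsEquivGeomPoints W L (pointsMap W L P)) = P)
    (ι : AlgebraicClosure F →ₐ[F] AlgebraicClosure E) (f : E →+* E')
    (ε : E' →+* AlgebraicClosure E) (hεf : ε.comp f = algebraMap E (AlgebraicClosure E))
    (hεL : ∀ l : L, ε (algebraMap L E' l) =
      ι ((algEquivOfEmb L (closureEmb (K := F) L)).symm (algebraMap L (AlgebraicClosure L) l)))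
    (hgen : Subring.closure (Set.range f ∪ Set.range (algebraMap L E')) = ⊤)
    (x : (W.baseChange L).galH1) (hx : x ∈ (W.baseChange L).localRestrictionKer E') :
    resH1Hom (resGalSubgroupOfEmb (galRange (K := F) L) ι) (pointsMapOfEmb W ι)
      (smul_compat_resGalSubgroupOfEmb W (galRange (K := F) L) ι)
        (resH1Hom (rangeToResGal (K := F) L) ψ hψ x) = 0 := by
  let ιL : AlgebraicClosure F ≃ₐ[F] AlgebraicClosure L := algEquivOfEmb L (closureEmb (K := F) L)
  -- (1) `Ē` is an algebraic `E'`-algebra through `ε`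
  letI : Algebra E' (AlgebraicClosure E) := ε.toAlgebra
  letI : Algebra E E' := f.toAlgebra
  haveI : IsScalarTower E E' (AlgebraicClosure E) :=
    IsScalarTower.of_algebraMap_eq fun a ↦ (RingHom.congr_fun hεf a).symm
  haveI : Algebra.IsAlgebraic E' (AlgebraicClosure E) := Algebra.IsAlgebraic.tower_top (K := E) E'
  -- (2) `ι₂ : Ē ≃ Ē'` over `E'`
  let ι₂₀ : AlgebraicClosure E →ₐ[E'] AlgebraicClosure E' := IsAlgClosed.lift
  have hι₂bij : Function.Bijective ι₂₀ := by
    letI : Algebra (AlgebraicClosure E) (AlgebraicClosure E') := ι₂₀.toRingHom.toAlgebra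
    haveI : IsScalarTower E' (AlgebraicClosure E) (AlgebraicClosure E') :=
      IsScalarTower.of_algebraMap_eq fun y ↦ (ι₂₀.commutes y).symm
    haveI : Algebra.IsAlgebraic (AlgebraicClosure E) (AlgebraicClosure E') :=
      Algebra.IsAlgebraic.tower_top (K := E') (AlgebraicClosure E)
    exact IsAlgClosed.algebraMap_bijective_of_isIntegral (k := AlgebraicClosure E) (K := AlgebraicClosure E')
  let ι₂ : AlgebraicClosure E ≃+* AlgebraicClosure E' := RingEquiv.ofBijective ι₂₀.toRingHom hι₂bij
  have hι₂ε : ∀ y : E', ι₂ (ε y) = algebraMap E' (AlgebraicClosure E') y := fun y ↦ ι₂₀.commutes y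
  have hι₂symm : ∀ y : E', ι₂.symm (algebraMap E' (AlgebraicClosure E') y) = ε y := fun y ↦ by
    rw [← hι₂ε, RingEquiv.symm_apply_apply]
  -- (3) `ι' : L̄ → Ē'` over `L`, with `ι' ∘ ι_L = ι₂ ∘ ι`
  have hι'L : ∀ l : L,
      ι₂ (ι (ιL.symm (algebraMap L (AlgebraicClosure L) l))) = algebraMap L (AlgebraicClosure E') l := fun l ↦ by
    rw [← hεL l, hι₂ε, ← IsScalarTower.algebraMap_apply]
  let ι' : AlgebraicClosure L →ₐ[L] AlgebraicClosure E' :=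
    { ι₂.toRingHom.comp (ι.toRingHom.comp (ιL.symm : AlgebraicClosure L →+* AlgebraicClosure F)) with
      commutes' := fun l ↦ hι'L l }
  have hι'apply : ∀ z', ι' z' = ι₂ (ι (ιL.symm z')) := fun _ ↦ rfl
  have hcompat : ∀ z, ι' (closureEmb (K := F) L z) = ι₂ (ι z) := fun z ↦ by
    rw [hι'apply, ← algEquivOfEmb_apply L (closureEmb (K := F) L) z, AlgEquiv.symm_apply_apply]
  -- (4) the elements of `Γ_E` restricting into `galRange L` fix `ι₂⁻¹(E') = ε(E')`
  have hfix : ∀ h : Field.absoluteGaloisGroup E, resGalOfEmb ι h ∈ galRange (K := F) L → ∀ y : E',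
      (show AlgebraicClosure E ≃ₐ[E] AlgebraicClosure E from h)
        (ι₂.symm (algebraMap E' (AlgebraicClosure E') y)) =
          ι₂.symm (algebraMap E' (AlgebraicClosure E') y) := by
    intro h hh y
    obtain ⟨σ', hσ'⟩ := hh
    rw [hι₂symm]
    have hσ : resGal (K := F) L σ' = resGalOfEmb ι h := hσ'
    have key : (((show AlgebraicClosure E ≃ₐ[E] AlgebraicClosure E from h) :
        AlgebraicClosure E →+* AlgebraicClosure E).comp ε) = ε := by
      refine RingHom.eq_of_eqOn_set_dense hgen ?_
      rintro _ (⟨a, rfl⟩ | ⟨l, rfl⟩)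
      · have hfa : ε (f a) = algebraMap E (AlgebraicClosure E) a := RingHom.congr_fun hεf a
        change (show AlgebraicClosure E ≃ₐ[E] AlgebraicClosure E from h) (ε (f a)) = ε (f a)
        rw [hfa]
        exact AlgEquiv.commutes _ a
      · have hz : (show AlgebraicClosure F ≃ₐ[F] AlgebraicClosure F from resGalOfEmb ι h)
            (ιL.symm (algebraMap L (AlgebraicClosure L) l)) = ιL.symm (algebraMap L (AlgebraicClosure L) l) := by
          apply ιL.injective
          rw [← hσ]
          have e := algEquivOfEmb_resGal_apply L σ' (ιL.symm (algebraMap L (AlgebraicClosure L) l))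
          refine e.trans ?_
          change (show AlgebraicClosure L ≃ₐ[L] AlgebraicClosure L from σ') (ιL (ιL.symm _)) = ιL (ιL.symm _)
          rw [AlgEquiv.apply_symm_apply, AlgEquiv.commutes]
        change (show AlgebraicClosure E ≃ₐ[E] AlgebraicClosure E from h) (ε (algebraMap L E' l)) =
          ε (algebraMap L E' l)
        rw [hεL l]
        exact (apply_resGalAuxOfEmb_apply ι h _).symm.trans (congrArg ι hz)
    exact RingHom.congr_fun key y
  -- (5) the `L`-side local condition at `ι'` (independent of the embedding), and the transfer
  have hx' : x ∈ (W.baseChange L).localRestrictionKerOfEmb ι' := by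
    rw [(W.baseChange L).localRestrictionKerOfEmb_eq_holds E' ι']
    exact hx
  exact resH1Hom_model_eq_zero_of_transport L W ι ι₂ ι' hcompat hfix ψ hψ hψspec x hx'

omit [Algebra F E'] [IsScalarTower F L E'] [PerfectField L] in
/-- The ring homomorphism `φ = ι ∘ j_L : L → Ē`, `j_L = ι_L⁻¹ ∘ (L → L̄)`, restricted to `F`. [folklore] -/
private theorem comp_embIntoClosure_comp_algebraMap (ι : AlgebraicClosure F →ₐ[F] AlgebraicClosure E) :
    (ι.toRingHom.comp (((algEquivOfEmb L (closureEmb (K := F) L)).symm :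
        AlgebraicClosure L →+* AlgebraicClosure F).comp (algebraMap L (AlgebraicClosure L)))).comp (algebraMap F L) =
      (algebraMap E (AlgebraicClosure E)).comp (algebraMap F E) := by
  ext x
  change ι ((algEquivOfEmb L (closureEmb (K := F) L)).symm (algebraMap L (AlgebraicClosure L) (algebraMap F L x))) =
    algebraMap E _ (algebraMap F E x)
  rw [← IsScalarTower.algebraMap_apply F L (AlgebraicClosure L), AlgEquiv.commutes, AlgHom.commutes,
    ← IsScalarTower.algebraMap_apply]

variable [NumberField F] [NumberField L] [IsGalois F L]
  (hψ : ∀ (n : galRange (K := F) L) (Q : geomPoints (W.baseChange L)), ψ (rangeToResGal (K := F) L n • Q) = n • ψ Q)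
  (hψspec : ∀ P : geomPoints W, ψ (localPointsEquivGeomPoints W L (pointsMap W L P)) = P)

omit [Algebra F E] [Algebra L E'] [Algebra F E'] [IsScalarTower F L E'] in
include hψspec in
/-- **Finite places, every embedding.** For `x ∈ Ш(E_L/L)`, every finite place `v` of `F` and EVERY `F`-embedding
`ι : F̄ → (F_v)‾`, the model class of `x` dies under the local restriction attached to `ι` on
`H_ι = (res_ι)⁻¹(galRange L)`: `ι ∘ j_L` factors through some `L_w`, `w ∣ v` (`exists_place_factorisation`), and the local
step applies with `E' = L_w = ⟨F_v, L⟩`. [cite: NeukirchSchmidtWingberg2008, I.§5] [cite: MilneADT2006, I.§6 Rem. 6.10] -/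
theorem resH1Hom_model_eq_zero_adicCompletion (v : HeightOneSpectrum (𝓞 F))
    (ι : AlgebraicClosure F →ₐ[F] AlgebraicClosure (v.adicCompletion F))
    (x : (W.baseChange L).galH1) (hx : x ∈ (W.baseChange L).sha) :
    resH1Hom (resGalSubgroupOfEmb (galRange (K := F) L) ι) (pointsMapOfEmb W ι)
      (smul_compat_resGalSubgroupOfEmb W (galRange (K := F) L) ι)
        (resH1Hom (rangeToResGal (K := F) L) ψ hψ x) = 0 := by
  let ιL : AlgebraicClosure F ≃ₐ[F] AlgebraicClosure L := algEquivOfEmb L (closureEmb (K := F) L)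
  let φ : L →+* AlgebraicClosure (v.adicCompletion F) :=
    ι.toRingHom.comp ((ιL.symm : AlgebraicClosure L →+* AlgebraicClosure F).comp (algebraMap L (AlgebraicClosure L)))
  have hφapply : ∀ l, φ l = ι (ιL.symm (algebraMap L (AlgebraicClosure L) l)) := fun _ ↦ rfl
  obtain ⟨w, hw, ε, hεf, hεφ⟩ := exists_place_factorisation L v
    (algebraMap (v.adicCompletion F) (AlgebraicClosure (v.adicCompletion F))) φ
    (comp_embIntoClosure_comp_algebraMap L ι)
  exact resH1Hom_model_eq_zero_of_factorisation L W ψ hψ hψspec ι (adicCompletionMap (K := F) L v w) ε hεf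
    (fun l ↦ (RingHom.congr_fun hεφ l).trans (hφapply l)) (closure_range_adicCompletionMap_union_eq_top L v w) x
    (((W.baseChange L).mem_sha_iff x).1 hx |>.1 w)

omit [Algebra F E] [Algebra L E'] [Algebra F E'] [IsScalarTower F L E'] [NumberField F] in
include hψspec in
/-- **Infinite places, every embedding**: the same at an infinite place `v` of `F`, with `E' = L_w`, `w ∣ v`
(`exists_infinitePlace_factorisation`). [cite: NeukirchSchmidtWingberg2008, I.§5] [cite: MilneADT2006, I.§6 Rem. 6.10] -/
theorem resH1Hom_model_eq_zero_infinitePlace (v : InfinitePlace F)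
    (ι : AlgebraicClosure F →ₐ[F] AlgebraicClosure v.Completion)
    (x : (W.baseChange L).galH1) (hx : x ∈ (W.baseChange L).sha) :
    resH1Hom (resGalSubgroupOfEmb (galRange (K := F) L) ι) (pointsMapOfEmb W ι)
      (smul_compat_resGalSubgroupOfEmb W (galRange (K := F) L) ι)
        (resH1Hom (rangeToResGal (K := F) L) ψ hψ x) = 0 := by
  let ιL : AlgebraicClosure F ≃ₐ[F] AlgebraicClosure L := algEquivOfEmb L (closureEmb (K := F) L)
  let φ : L →+* AlgebraicClosure v.Completion :=
    ι.toRingHom.comp ((ιL.symm : AlgebraicClosure L →+* AlgebraicClosure F).comp (algebraMap L (AlgebraicClosure L)))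
  have hφapply : ∀ l, φ l = ι (ιL.symm (algebraMap L (AlgebraicClosure L) l)) := fun _ ↦ rfl
  obtain ⟨w, hw, ε, hεf, hεφ⟩ := exists_infinitePlace_factorisation L v
    (algebraMap v.Completion (AlgebraicClosure v.Completion)) φ (comp_embIntoClosure_comp_algebraMap L ι)
  haveI : IsScalarTower F L w.Completion := isScalarTower_completion L w
  exact resH1Hom_model_eq_zero_of_factorisation L W ψ hψ hψspec ι
    (NumberField.LiesOver.completionMap (v := v) (w := w)) ε hεf
    (fun l ↦ (RingHom.congr_fun hεφ l).trans (hφapply l)) (closure_range_completionMap_union_eq_top L v w) x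
    (((W.baseChange L).mem_sha_iff x).1 hx |>.2 w)

end Factorisation

/-! ## §5 The `g_*` form at the chosen embedding (the hypothesis of Clark–Sharif's local triviality) -/

section Conj

variable (K : Type) [Field K] [NumberField K] [IsGalois ℚ K] [(galRange (K := ℚ) K).Normal] (W : WeierstrassCurve ℚ)

/-- **Finite places, every conjugate.** For `x ∈ Ш(E_K/K)`, a finite place `v` of `ℚ` and every `g ∈ Γ_ℚ`, the
conjugate `g_* (galH1Model x)` dies under the local restriction at the CHOSEN embedding `ℚ̄ → (ℚ_v)‾` on
`(resGal ℚ_v)⁻¹(galRange K)` — §4 at the embedding `closureEmb ∘ g`, moved back by §1.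
[cite: NeukirchSchmidtWingberg2008, I.§5] [cite: SerreGaloisCohomology1997, II.§1.1] -/
theorem resH1Hom_conjH1_galH1Model_eq_zero_adicCompletion (v : HeightOneSpectrum (𝓞 ℚ))
    (g : Field.absoluteGaloisGroup ℚ) (x : (W.baseChange K).galH1) (hx : x ∈ (W.baseChange K).sha) :
    resH1Hom (comapRestrict (galRange (K := ℚ) K) (resGal (K := ℚ) (v.adicCompletion ℚ)))
      (pointsMap W (v.adicCompletion ℚ))
      (smul_compat_comapRestrict (galRange (K := ℚ) K) (resGal (K := ℚ) (v.adicCompletion ℚ))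
        (pointsMap W (v.adicCompletion ℚ)) (pointsMap_smul W (v.adicCompletion ℚ)))
      (Literature.NumberTheory.EllipticCurves.conjH1 (galRange (K := ℚ) K) (geomPoints W) g (galH1Model K W x)) = 0 := by
  have h := resH1Hom_model_eq_zero_adicCompletion K W (geomPointsEquivBaseChange K W).symm.toAddMonoidHom
    (geomPointsEquivBaseChange_symm_smul K W) (fun P ↦ (geomPointsEquivBaseChange K W).symm_apply_apply P) v
    ((closureEmb (K := ℚ) (v.adicCompletion ℚ)).comp
      ((show @AlgEquiv ℚ (AlgebraicClosure ℚ) (AlgebraicClosure ℚ) _ _ _ (AlgebraicClosure.instAlgebra ℚ)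
          (AlgebraicClosure.instAlgebra ℚ) from g) :
        @AlgHom ℚ (AlgebraicClosure ℚ) (AlgebraicClosure ℚ) _ _ _ (AlgebraicClosure.instAlgebra ℚ)
          (AlgebraicClosure.instAlgebra ℚ))) x hx
  exact (resH1Hom_resGalSubgroupOfEmb_comp_eq_zero_iff W (galRange (K := ℚ) K)
    (closureEmb (K := ℚ) (v.adicCompletion ℚ)) _ (galH1Model K W x)).mp h

/-- **Infinite places, every conjugate**: the same at the infinite place of `ℚ`.
[cite: NeukirchSchmidtWingberg2008, I.§5] [cite: SerreGaloisCohomology1997, II.§1.1] -/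
theorem resH1Hom_conjH1_galH1Model_eq_zero_infinitePlace (v : InfinitePlace ℚ)
    (g : Field.absoluteGaloisGroup ℚ) (x : (W.baseChange K).galH1) (hx : x ∈ (W.baseChange K).sha) :
    resH1Hom (comapRestrict (galRange (K := ℚ) K) (resGal (K := ℚ) v.Completion))
      (pointsMap W v.Completion)
      (smul_compat_comapRestrict (galRange (K := ℚ) K) (resGal (K := ℚ) v.Completion)
        (pointsMap W v.Completion) (pointsMap_smul W v.Completion))
      (Literature.NumberTheory.EllipticCurves.conjH1 (galRange (K := ℚ) K) (geomPoints W) g (galH1Model K W x)) = 0 := by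
  have h := resH1Hom_model_eq_zero_infinitePlace K W (geomPointsEquivBaseChange K W).symm.toAddMonoidHom
    (geomPointsEquivBaseChange_symm_smul K W) (fun P ↦ (geomPointsEquivBaseChange K W).symm_apply_apply P) v
    ((closureEmb (K := ℚ) v.Completion).comp
      ((show @AlgEquiv ℚ (AlgebraicClosure ℚ) (AlgebraicClosure ℚ) _ _ _ (AlgebraicClosure.instAlgebra ℚ)
          (AlgebraicClosure.instAlgebra ℚ) from g) :
        @AlgHom ℚ (AlgebraicClosure ℚ) (AlgebraicClosure ℚ) _ _ _ (AlgebraicClosure.instAlgebra ℚ)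
          (AlgebraicClosure.instAlgebra ℚ))) x hx
  exact (resH1Hom_resGalSubgroupOfEmb_comp_eq_zero_iff W (galRange (K := ℚ) K)
    (closureEmb (K := ℚ) v.Completion) _ (galH1Model K W x)).mp h

end Conj

/-! ## §6 ★ Corestriction maps `Ш(E_K/K)` into `Ш(E/ℚ)` -/

section Sha

variable (K : Type) [Field K] [NumberField K] [IsGalois ℚ K] [(galRange (K := ℚ) K).Normal]
  [Fintype (Field.absoluteGaloisGroup ℚ ⧸ galRange (K := ℚ) K)] (W : WeierstrassCurve ℚ)

/-- **Local triviality of `cores (galH1Model x)` at a finite place**, `x ∈ Ш(E_K/K)`: Clark–Sharif's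
`resH1Hom_coresH1_eq_zero` (the Mackey formula `res_v ∘ cores = Σ_{w ∣ v} cores_w ∘ res_w`) with §5.
[cite: ClarkSharif2010, §3.6 (last paragraph)] [cite: NeukirchSchmidtWingberg2008, I.§5] -/
theorem coresH1_galH1Model_mem_localRestrictionKer_adicCompletion (v : HeightOneSpectrum (𝓞 ℚ))
    (x : (W.baseChange K).galH1) (hx : x ∈ (W.baseChange K).sha) :
    coresH1 (galRange (K := ℚ) K) (isOpen_galRange (K := ℚ) K) (galH1Model K W x) ∈
      W.localRestrictionKer (v.adicCompletion ℚ) := by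
  haveI : Fintype (Field.absoluteGaloisGroup (v.adicCompletion ℚ) ⧸
      (galRange (K := ℚ) K).comap ((resGal (K := ℚ) (v.adicCompletion ℚ) :
        Field.absoluteGaloisGroup (v.adicCompletion ℚ) →ₜ* Field.absoluteGaloisGroup ℚ) :
          Field.absoluteGaloisGroup (v.adicCompletion ℚ) →* Field.absoluteGaloisGroup ℚ)) :=
    @Fintype.ofFinite _ (finite_quotientComap (galRange (K := ℚ) K) _)
  rw [WeierstrassCurve.localRestrictionKer, resKer_eq_ker, AddMonoidHom.mem_ker]
  exact resH1Hom_coresH1_eq_zero (galRange (K := ℚ) K) (resGal (K := ℚ) (v.adicCompletion ℚ))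
    (pointsMap W (v.adicCompletion ℚ)) (pointsMap_smul W (v.adicCompletion ℚ)) (isOpen_galRange (K := ℚ) K)
    (galH1Model K W x) fun g ↦ resH1Hom_conjH1_galH1Model_eq_zero_adicCompletion K W v g x hx

/-- **Local triviality of `cores (galH1Model x)` at the infinite place**, `x ∈ Ш(E_K/K)`.
[cite: ClarkSharif2010, §3.6 (last paragraph)] [cite: NeukirchSchmidtWingberg2008, I.§5] -/
theorem coresH1_galH1Model_mem_localRestrictionKer_infinitePlace (v : InfinitePlace ℚ)
    (x : (W.baseChange K).galH1) (hx : x ∈ (W.baseChange K).sha) :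
    coresH1 (galRange (K := ℚ) K) (isOpen_galRange (K := ℚ) K) (galH1Model K W x) ∈
      W.localRestrictionKer v.Completion := by
  haveI : Fintype (Field.absoluteGaloisGroup v.Completion ⧸
      (galRange (K := ℚ) K).comap ((resGal (K := ℚ) v.Completion :
        Field.absoluteGaloisGroup v.Completion →ₜ* Field.absoluteGaloisGroup ℚ) :
          Field.absoluteGaloisGroup v.Completion →* Field.absoluteGaloisGroup ℚ)) :=
    @Fintype.ofFinite _ (finite_quotientComap (galRange (K := ℚ) K) _)
  rw [WeierstrassCurve.localRestrictionKer, resKer_eq_ker, AddMonoidHom.mem_ker]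
  exact resH1Hom_coresH1_eq_zero (galRange (K := ℚ) K) (resGal (K := ℚ) v.Completion)
    (pointsMap W v.Completion) (pointsMap_smul W v.Completion) (isOpen_galRange (K := ℚ) K)
    (galH1Model K W x) fun g ↦ resH1Hom_conjH1_galH1Model_eq_zero_infinitePlace K W v g x hx

/-- ★ **CORESTRICTION MAPS `Ш(E_K/K)` INTO `Ш(E/ℚ)`.**  For an elliptic curve `E = W/ℚ`, a finite Galois `K/ℚ` (so
`galRange K ≤ Γ_ℚ` is open, normal, of finite index) and `x ∈ Ш(E_K/K) ⊆ H¹(K, E_K)`: the corestriction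
`cores (galH1Model x) ∈ H¹(ℚ, E)` of the model class `galH1Model x ∈ H¹(galRange K, E(ℚ̄))` lies in `Ш(E/ℚ)` — it is
locally trivial at every finite and every infinite place of `ℚ` (the double-coset formula
`res_v ∘ cor = Σ_{w ∣ v} cor_{K_w/ℚ_v} ∘ res_w`, Milne ADT I Rem. 6.10, NSW I.§5; here: Clark–Sharif local triviality +
place factorisation + transport).  UNCONDITIONAL.  This is the «NOT HERE (by design)» clause of
`Literature/…/ShaCorestrictionIndexTwo.lean`; with `corH1_eq_coresH1` it discharges the binders `hcorE`/`hcorT` of the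
one-bit-law files (sequel).  BSD is NOT proved by this. [cite: MilneADT2006, I.§6 Rem. 6.10]
[cite: NeukirchSchmidtWingberg2008, I.§5] [cite: ClarkSharif2010, §3.6] -/
theorem coresH1_galH1Model_mem_sha (x : (W.baseChange K).galH1) (hx : x ∈ (W.baseChange K).sha) :
    coresH1 (galRange (K := ℚ) K) (isOpen_galRange (K := ℚ) K) (galH1Model K W x) ∈ W.sha := by
  rw [WeierstrassCurve.mem_sha_iff]
  exact ⟨fun v ↦ coresH1_galH1Model_mem_localRestrictionKer_adicCompletion K W v x hx,
    fun v ↦ coresH1_galH1Model_mem_localRestrictionKer_infinitePlace K W v x hx⟩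

end Sha

end Summit.BirchSwinnertonDyer.BirchSwinnertonDyer.Theorems.GenusExact.ShaCores

end
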